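import Summits.BirchSwinnertonDyer.BirchSwinnertonDyer.Theses.RamifiedHeegnerPair
import HarnessLib

/-!
# Route `RamifiedHeegnerPair`: the glue `PublishedInputTwistsGlue` (stmt-BirchSwinnertonDyer-25144) CLOSED

`PublishedInputBFH → PublishedInputFH → NewformOfEllipticCurve → PublishedInputParity → PublishedInputTwists` —
conjunction introduction (pen pss3 g12, rev 4 split of 25112 into single-constant children). Pure logic; BSD is not
proved by any of this (prover bsd-wall-utd-p3 g8).
-/

set_option linter.dupNamespace false

namespace Summit.BirchSwinnertonDyer.BirchSwinnertonDyer.Theorems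

open Summit.BirchSwinnertonDyer.BirchSwinnertonDyer.Theses.RamifiedHeegnerPair

/-- **Glue 25144**: the four displayed published inputs reassemble the bundle `PublishedInputTwists`. [folklore] -/
theorem publishedInputTwistsGlue_proof : PublishedInputTwistsGlue :=
  fun a b c d ↦ ⟨a, b, c, d⟩

end Summit.BirchSwinnertonDyer.BirchSwinnertonDyer.Theorems
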